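import Mathlib.RingTheory.PiTensorProduct
import Mathlib.LinearAlgebra.PiTensorProduct.DirectSum
import Mathlib.Algebra.DirectSum.Module
import Mathlib.RingTheory.TensorProduct.Basic
import Mathlib.RingTheory.Flat.Basic
import Mathlib.LinearAlgebra.Basis.VectorSpace
import Mathlib.LinearAlgebra.Span.Defs
import Mathlib.FieldTheory.Separable
import HarnessLib

/-!
# [IUTchIII] Propositions 3.1, 3.2: local holomorphic / mono-analytic tensor packets
# (abc-iut cell, layer L6, slice [IUTchIII] §3)

S. Mochizuki, *Inter-universal Teichmüller theory III*, kurims manuscript (May 2020) of PRIMS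
**57** (2021), §3: Proposition 3.1 "(Local Holomorphic Tensor Packets)" pp. 92–93, Remark 3.1.1
(i) pp. 93–94, Remark 3.1.2 p. 97, Proposition 3.2 "(Local Mono-analytic Tensor Packets)"
pp. 97–99, Remarks 3.2.1, 3.2.2 p. 99 (PRIMS offset ≈ +420). STATEMENTS-FIRST typing: the
tensor-packet CONSTRUCTIONS are real Mathlib objects (finite products and `PiTensorProduct`s over
the base field `𝕜 = ℚ_{v_ℚ}`); the displayed identification of Proposition 3.1,
`⊗_{α∈A} (⊕_{v|v_ℚ} log(^α𝓕_v)) = ⊕_{{v_α}} ⊗_{α∈A} log(^α𝓕_{v_α})`, is a REAL linear equivalence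
(`packetDecomposition`, Mathlib's `PiTensorProduct.ofDirectSumEquiv`); the remaining printed
assertions ("follow immediately from the definitions", p. 93, p. 99) are typed as named
`Prop`-valued facts or proved where they are pure algebra.

**Interface level (plan/FOUNDATIONS.md boundary).** The inputs — the ind-topological fields
`log(^α𝓕_v)` attached to an `𝓕`-prime-strip by [IUTchIII] Definition 1.1 (i)–(iii) (layer L6,
seat abc-iut-L6-t3) and the mono-analytic log-shells `𝓘_{†𝒟^⊢_v} ⊆ log(†𝒟^⊢_v)` of
[IUTchIII] Proposition 1.2 (vi)–(viii) — enter as FAMILIES OF TYPES WITH INSTANCES indexed by the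
capsule index set `A` and the finite set `Vfib` of `v ∈ 𝕍` over the fixed `v_ℚ`: a commutative
`𝕜`-algebra `L α v` (holomorphic case; a field in the intended model, Remark 3.1.1 (i)) resp. a
`𝕜`-module `D α v` (mono-analytic case), together with distinguished subsets (integral structures
`Ψ ∪ {0} ≅ 𝒪_{k̄}`, log-shells `𝓘`). TODO-merge: abc-iut-L6-t3 (Def. 1.1, Prop. 1.2 of [IUTchIII]).
The ind-topologies and the `^αΠ_v`-actions are NOT modelled here (the text's "inductive limit of
topological modules of finite dimension over `ℚ_{v_ℚ}`", p. 92, is recorded in the docstrings);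
every object below is the underlying algebraic object. Archimedean integral structures of
Proposition 3.2 (ii) (closed unit balls of Hermitian metrics) are typed as a named datum/fact only.
Tag form [claim: Mochizuki2012, status: disputed] (D-0012 claim key; the constructions themselves
are undisputed multilinear algebra).
-/

namespace Literature.IUT.LogThetaLattice

open scoped TensorProduct DirectSum
open PiTensorProduct

universe u v v' w

/-! ### Proposition 3.1: local holomorphic tensor packets -/

section Holomorphic

variable (𝕜 : Type u) [Field 𝕜]
variable {A : Type v} [Fintype A] [DecidableEq A]
variable {Vfib : Type v'} [Fintype Vfib] [DecidableEq Vfib]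
variable (L : A → Vfib → Type w) [∀ α v, CommRing (L α v)] [∀ α v, Algebra 𝕜 (L α v)]

/-- The **[1-]tensor packet** `log(^α𝓕_{v_ℚ}) := ⊕_{𝕍 ∋ v | v_ℚ} log(^α𝓕_v)` associated to the
`𝓕`-prime-strip `^α𝓕` ([IUTchIII] Proposition 3.1, first display, p. 92), as the underlying
commutative `𝕜`-algebra (`𝕜 = ℚ_{v_ℚ}`; finite direct sum = product over the finite fibre `Vfib`
of `𝕍` over `v_ℚ`). [claim: Mochizuki2012, status: disputed] -/
abbrev Packet1 (α : A) : Type _ := ∀ v : Vfib, L α v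

/-- The **[n-]tensor packet** `log(^A𝓕_{v_ℚ}) := ⊗_{α∈A} log(^α𝓕_{v_ℚ})` associated to the
`n`-capsule `{^α𝓕}_{α∈A}` of `𝓕`-prime-strips ([IUTchIII] Proposition 3.1, second display, p. 92),
as the underlying commutative `𝕜`-algebra (Mathlib `PiTensorProduct` over `𝕜 = ℚ_{v_ℚ}`; the text's
tensor product "of ind-topological modules"). [claim: Mochizuki2012, status: disputed] -/
abbrev PacketN : Type _ := ⨂[𝕜] α : A, Packet1 L α

/-- The direct summand `⊗_{α∈A} log(^α𝓕_{v_α})` of the `n`-tensor packet indexed by a collection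
`{v_α}_{α∈A}` of (not necessarily distinct) elements of `𝕍` over `v_ℚ` ([IUTchIII] Proposition
3.1, right-hand side of the second display, p. 92). [claim: Mochizuki2012, status: disputed] -/
abbrev PacketSummand (vA : A → Vfib) : Type _ := ⨂[𝕜] α : A, L α (vA α)

/-- **The displayed identification of [IUTchIII] Proposition 3.1** (p. 92):
`⊗_{α∈A} log(^α𝓕_{v_ℚ}) = ⊕_{{v_α}_{α∈A}} ( ⊗_{α∈A} log(^α𝓕_{v_α}) )`, "the direct sum [being]
over all collections `{v_α}_{α∈A}` of [not necessarily distinct!] elements `v_α ∈ 𝕍` lying over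
`v_ℚ`", realised as a `𝕜`-linear equivalence (the `n`-ary tensor product distributes over finite
direct sums: Mathlib `PiTensorProduct.ofDirectSumEquiv`). [claim: Mochizuki2012, status: disputed] -/
noncomputable def packetDecomposition :
    PacketN 𝕜 L ≃ₗ[𝕜] (∀ vA : A → Vfib, PacketSummand 𝕜 L vA) :=
  (PiTensorProduct.congr fun α => (DirectSum.linearEquivFunOnFintype 𝕜 Vfib (L α)).symm)
    |>.trans <| (PiTensorProduct.ofDirectSumEquiv (R := 𝕜) (M := L)).trans
      (DirectSum.linearEquivFunOnFintype 𝕜 (A → Vfib) fun vA => PacketSummand 𝕜 L vA)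

omit [DecidableEq Vfib] in
/-- On pure tensors the identification of Proposition 3.1 (p. 92) is the evident one:
`⊗_α x_α ↦ ( {v_α} ↦ ⊗_α (x_α)_{v_α} )`. [claim: Mochizuki2012, status: disputed] -/
theorem packetDecomposition_tprod (x : ∀ α, Packet1 L α) (vA : A → Vfib) :
    packetDecomposition 𝕜 L (tprod 𝕜 x) vA = tprod 𝕜 fun α => x α (vA α) := by
  simp only [packetDecomposition, LinearEquiv.trans_apply, PiTensorProduct.congr_tprod,
    DirectSum.linearEquivFunOnFintype_apply]
  rw [PiTensorProduct.ofDirectSumEquiv_tprod_apply]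
  rfl

/-- `log(^{A,α}𝓕_v) := log(^α𝓕_v) ⊗ ( ⊗_{β ∈ A∖{α}} log(^β𝓕_{v_ℚ}) ) ⊆ log(^A𝓕_{v_ℚ})`
([IUTchIII] Proposition 3.1 (ii), display, p. 93): "the ind-topological submodule determined by the
tensor product of the factors labeled by `β ∈ A∖{α}` with … the direct summand with subscript `v` of
the factor labeled `α`", typed as the (binary) tensor product `𝕜`-algebra; that it is a direct
summand of `log(^A𝓕_{v_ℚ})` is `Prop31ii_directSummand`. [claim: Mochizuki2012, status: disputed] -/
abbrev PacketAt (α : A) (v : Vfib) : Type _ :=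
  (L α v) ⊗[𝕜] (⨂[𝕜] β : {β : A // β ≠ α}, Packet1 L β.1)

/-- The natural homomorphism of (ind-topological) rings `log(^α𝓕_v) → log(^{A,α}𝓕_v)` obtained
"by forming the tensor product with 1's in the factors labeled by `β ∈ A∖{α}`" ([IUTchIII]
Proposition 3.1 (ii), p. 93). [claim: Mochizuki2012, status: disputed] -/
noncomputable def toPacketAt (α : A) (v : Vfib) : L α v →ₐ[𝕜] PacketAt 𝕜 L α v :=
  Algebra.TensorProduct.includeLeft

omit [Fintype A] [DecidableEq A] [Fintype Vfib] [DecidableEq Vfib] in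
/-- **Injectivity** of `log(^α𝓕_v) → log(^{A,α}𝓕_v)` ([IUTchIII] Proposition 3.1 (ii), p. 93:
"a natural injective homomorphism of ind-topological rings"), PROVED for the underlying algebras
whenever the complementary tensor factor is nonzero (over the field `𝕜` every module is flat).
[claim: Mochizuki2012, status: disputed] -/
theorem toPacketAt_injective (α : A) (v : Vfib)
    [Nontrivial (⨂[𝕜] β : {β : A // β ≠ α}, Packet1 L β.1)] :
    Function.Injective (toPacketAt 𝕜 L α v) :=
  Algebra.TensorProduct.includeLeft_injective (RingHom.injective _)

/-- [IUTchIII] Proposition 3.1 (i) "(Ring Structures)", p. 93, at one finite level of the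
inductive limit: "`log(^A𝓕_{v_ℚ})` may be regarded as an inductive limit of direct sums of
ind-topological fields" — i.e. (when the `log(^α𝓕_v)` are replaced by finite separable
subextensions) the tensor packet ring decomposes as a finite product of fields; "such
decompositions … are uniquely determined by the … ring structure" (automatic for a reduced artinian
ring) "and … compatible … with the natural action of `^αΠ_v`" (not modelled: TODO ind-topology /
group actions). Typed as a named statement. [claim: Mochizuki2012, status: disputed] -/
def Prop31i_ringStructures : Prop :=
  ∃ (ι : Type (max u v v' w)) (_ : Fintype ι) (K : ι → Type (max u v v' w))
    (_ : ∀ i, Field (K i)), Nonempty (PacketN 𝕜 L ≃+* ∀ i, K i)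

/-- [IUTchIII] Proposition 3.1 (ii), first two assertions, p. 93: "`log(^{A,α}𝓕_v)` forms a direct
summand of the ind-topological ring `log(^A𝓕_{v_ℚ})`" — typed as: there is a `𝕜`-algebra
homomorphism `log(^{A,α}𝓕_v) → log(^A𝓕_{v_ℚ})` with a `𝕜`-linear retraction (the remaining
clauses — "inductive limit of direct sums of ind-topological fields … uniquely determined" — are
the analogue of `Prop31i_ringStructures` for `log(^{A,α}𝓕_v)`). [claim: Mochizuki2012, status: disputed] -/
def Prop31ii_directSummand (α : A) (v : Vfib) : Prop :=
  ∃ (ι : PacketAt 𝕜 L α v →ₐ[𝕜] PacketN 𝕜 L) (ρ : PacketN 𝕜 L →ₗ[𝕜] PacketAt 𝕜 L α v),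
    ∀ x, ρ (ι x) = x

/-- [IUTchIII] Proposition 3.1 (ii), p. 93: the homomorphism `log(^α𝓕_v) → log(^{A,α}𝓕_v)`
"induces an isomorphism of [a cofinal finite-level object] in the domain onto each of the direct
summand ind-topological fields of the object in the codomain"; in particular the integral structure
`Ψ_{log(^α𝓕_v)} ∪ {0}` "determines integral structures on each of the direct summand
ind-topological fields that appear in … `log(^{A,α}𝓕_v)`, `log(^A𝓕_{v_ℚ})`". Typed at one finite
level: for every decomposition of `log(^{A,α}𝓕_v)` as a finite product of fields, each composite
`log(^α𝓕_v) → K_i` is injective and the image of the integral structure `O α v` is the induced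
integral structure. [claim: Mochizuki2012, status: disputed] -/
def Prop31ii_integralStructures (O : ∀ α v, Subring (L α v)) (α : A) (v : Vfib) : Prop :=
  ∀ (ι : Type (max u v v' w)) (_ : Fintype ι) (K : ι → Type (max u v v' w)) (_ : ∀ i, Field (K i))
    (e : PacketAt 𝕜 L α v ≃+* ∀ i, K i) (i : ι),
    Function.Injective (fun x : L α v => e (toPacketAt 𝕜 L α v x) i) ∧
      ∃ Oi : Subring (K i), ∀ x : L α v, x ∈ O α v ↔ e (toPacketAt 𝕜 L α v x) i ∈ Oi

/-- [IUTchIII] Remark 3.1.1 (i), pp. 93–94 — the intended model of the interface: for `v ∈ 𝕍`,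
`k := K_v`, `k̄` an algebraic closure, "`log(^α𝓕_v) ≅ k̄`; `Ψ_{log(^α𝓕_v)} ≅ 𝒪_{k̄}`;
`log(^{A,α}𝓕_v) ≅ ⊗ k̄ ≅ lim→ ⊕ k̄ ⊇ lim→ ⊕ 𝒪_{k̄}` — i.e., … each `log(^α𝓕_v)` is isomorphic to
`k̄`; each `log(^{A,α}𝓕_v)` is a topological tensor product [say, over `ℚ`] of copies of `k̄` …;
each `Ψ_{log(^α𝓕_v)}` is a copy of … `𝒪_{k̄} ⊆ k̄`". Typed as the statement that the interface data
`(L, O)` is (abstractly) isomorphic to given model data `(kbar, Okbar)`.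
[claim: Mochizuki2012, status: disputed] -/
def Remark311i_model (O : ∀ α v, Subring (L α v)) (kbar : Vfib → Type w)
    [∀ v, Field (kbar v)] [∀ v, Algebra 𝕜 (kbar v)] (Okbar : ∀ v, Subring (kbar v)) : Prop :=
  ∀ α v, ∃ e : L α v ≃ₐ[𝕜] kbar v, ∀ x, x ∈ O α v ↔ e x ∈ Okbar v

/-- [IUTchIII] Remark 3.1.2, p. 97: "The constructions involving local holomorphic tensor packets
given in Proposition 3.1 may be applied to the capsules that appear in the various 𝓕-prime-strip
processions", i.e. to the `(j+1)`-capsule with index set `S^±_{j+1}` (of cardinality `j+1`,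
[IUTchI] Prop. 4.11 (i), 6.9 (i)) of a procession: the `n`-tensor packet with `A := Fin (j+1)`.
[claim: Mochizuki2012, status: disputed] -/
abbrev ProcessionPacket (j : ℕ) (Lj : Fin (j + 1) → Vfib → Type w) [∀ α v, CommRing (Lj α v)]
    [∀ α v, Algebra 𝕜 (Lj α v)] : Type _ :=
  PacketN 𝕜 Lj

end Holomorphic

/-! ### Proposition 3.2: local mono-analytic tensor packets -/

section MonoAnalytic

variable (𝕜 : Type u) [Field 𝕜]
variable {A : Type v} [Fintype A] [DecidableEq A]
variable {Vfib : Type v'} [Fintype Vfib] [DecidableEq Vfib]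
variable (D : A → Vfib → Type w) [∀ α v, AddCommGroup (D α v)] [∀ α v, Module 𝕜 (D α v)]

/-- The mono-analytic **[1-]tensor packet** `log(^α𝒟^⊢_{v_ℚ}) := ⊕_{𝕍 ∋ v | v_ℚ} log(^α𝒟^⊢_v)`
associated to a `𝒟^⊢`-prime-strip ([IUTchIII] Proposition 3.2, first display, pp. 97–98), as
the underlying `𝕜`-module (`log(†𝒟^⊢_v)` = the module of [IUTchIII] Prop. 1.2 (vi), (vii); no
ring structure in the mono-analytic setting). The same notation serves for `𝓕^{⊢×μ}`-prime-strips
(p. 98: "by replacing `𝒟^⊢` … by `𝓕^{⊢×μ}`"). [claim: Mochizuki2012, status: disputed] -/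
abbrev MPacket1 (α : A) : Type _ := ∀ v : Vfib, D α v

/-- The mono-analytic **[n-]tensor packet** `log(^A𝒟^⊢_{v_ℚ}) := ⊗_{α∈A} log(^α𝒟^⊢_{v_ℚ})`
([IUTchIII] Proposition 3.2, second display, p. 98), as the underlying `𝕜`-module.
[claim: Mochizuki2012, status: disputed] -/
abbrev MPacketN : Type _ := ⨂[𝕜] α : A, MPacket1 D α

/-- `log(^{A,α}𝒟^⊢_v) ⊆ log(^A𝒟^⊢_{v_ℚ})`: "the ind-topological submodule determined by the tensor
product of the factors labeled by `β ∈ A∖{α}` with … the direct summand with subscript `v` of the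
factor labeled `α`" ([IUTchIII] Proposition 3.2, p. 98; cf. Proposition 3.1 (ii)).
[claim: Mochizuki2012, status: disputed] -/
abbrev MPacketAt (α : A) (v : Vfib) : Type _ :=
  (D α v) ⊗[𝕜] (⨂[𝕜] β : {β : A // β ≠ α}, MPacket1 D β.1)

variable {𝕜 D}
variable {L : A → Vfib → Type w} [∀ α v, CommRing (L α v)] [∀ α v, Algebra 𝕜 (L α v)]

/-- [IUTchIII] Proposition 3.2 (i) "(Mono-analytic/Holomorphic Compatibility)", p. 98, first
induced map: a family of isomorphisms `log(^α𝒟^⊢_v) ≅ log(^α𝓕_v)` (a member of the poly-isomorphism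
of [IUTchIII] Prop. 1.2 (vi), (vii)) induces `log(^α𝒟^⊢_{v_ℚ}) ≅ log(^α𝓕_{v_ℚ})` on 1-tensor
packets. [claim: Mochizuki2012, status: disputed] -/
def MPacket1.compat (α : A) (e : ∀ v, D α v ≃ₗ[𝕜] L α v) :
    MPacket1 D α ≃ₗ[𝕜] Packet1 L α :=
  LinearEquiv.piCongrRight e

/-- [IUTchIII] Proposition 3.2 (i), p. 98, second induced map: isomorphisms
`log(^α𝒟^⊢_v) ≅ log(^α𝓕_v)` for all `α, v` induce `log(^A𝒟^⊢_{v_ℚ}) ≅ log(^A𝓕_{v_ℚ})` on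
`n`-tensor packets (functoriality of `⊗`). [claim: Mochizuki2012, status: disputed] -/
noncomputable def MPacketN.compat (e : ∀ α v, D α v ≃ₗ[𝕜] L α v) :
    MPacketN 𝕜 D ≃ₗ[𝕜] PacketN 𝕜 L :=
  PiTensorProduct.congr fun α => MPacket1.compat α (e α)

/-- [IUTchIII] Proposition 3.2 (i), p. 98, third induced map: the isomorphisms induce
`log(^{A,α}𝒟^⊢_v) ≅ log(^{A,α}𝓕_v)`. [claim: Mochizuki2012, status: disputed] -/
noncomputable def MPacketAt.compat (e : ∀ α v, D α v ≃ₗ[𝕜] L α v) (α : A) (v : Vfib) :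
    MPacketAt 𝕜 D α v ≃ₗ[𝕜] PacketAt 𝕜 L α v :=
  TensorProduct.congr (e α v) (PiTensorProduct.congr fun β => MPacket1.compat β.1 (e β.1))

/-- The **poly**-isomorphism of [IUTchIII] Proposition 3.2 (i), p. 98 ("induce natural
poly-isomorphisms of ind-topological modules … between the various mono-analytic tensor packets
… and the holomorphic tensor packets"): the set of packet isomorphisms induced by the members of a
given poly-isomorphism (= set of families of component isomorphisms).
[claim: Mochizuki2012, status: disputed] -/
def MPacketN.polyCompat (P : Set (∀ α v, D α v ≃ₗ[𝕜] L α v)) :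
    Set (MPacketN 𝕜 D ≃ₗ[𝕜] PacketN 𝕜 L) :=
  {f | ∃ e ∈ P, f = MPacketN.compat e}

variable (𝕜 D)

/-- [IUTchIII] Proposition 3.2 (ii) "(Integral Structures)", nonarchimedean `v_ℚ`, first
inclusion, p. 98: the mono-analytic log-shells `𝓘_{†𝒟^⊢_v}` "determine [i.e., by forming suitable
direct sums …]" the submodule `𝓘(^α𝒟^⊢_{v_ℚ}) := ⊕_v 𝓘_{^α𝒟^⊢_v} ⊆ log(^α𝒟^⊢_{v_ℚ})` (log-shells
enter as additive subgroups `I α v`). [claim: Mochizuki2012, status: disputed] -/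
def shellPacket1 (I : ∀ α v, AddSubgroup (D α v)) (α : A) : AddSubgroup (MPacket1 D α) :=
  AddSubgroup.pi Set.univ fun v => I α v

/-- [IUTchIII] Proposition 3.2 (ii), nonarchimedean `v_ℚ`, second inclusion, p. 98:
`𝓘(^A𝒟^⊢_{v_ℚ}) ⊆ log(^A𝒟^⊢_{v_ℚ})`, "by forming suitable … tensor products": the additive subgroup
generated by the pure tensors `⊗_α x_α` with `x_α ∈ 𝓘(^α𝒟^⊢_{v_ℚ})`.
[claim: Mochizuki2012, status: disputed] -/
def shellPacketN (I : ∀ α v, AddSubgroup (D α v)) : AddSubgroup (MPacketN 𝕜 D) :=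
  AddSubgroup.closure
    {t | ∃ x : ∀ α, MPacket1 D α, (∀ α, x α ∈ shellPacket1 D I α) ∧ t = tprod 𝕜 x}

/-- [IUTchIII] Proposition 3.2 (ii), nonarchimedean `v_ℚ`, third inclusion, p. 98:
`𝓘(^{A,α}𝒟^⊢_v) ⊆ log(^{A,α}𝒟^⊢_v)`: generated by the tensors `x ⊗ (⊗_β y_β)` with `x ∈ 𝓘_{^α𝒟^⊢_v}`,
`y_β ∈ 𝓘(^β𝒟^⊢_{v_ℚ})`. [claim: Mochizuki2012, status: disputed] -/
def shellPacketAt (I : ∀ α v, AddSubgroup (D α v)) (α : A) (v : Vfib) :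
    AddSubgroup (MPacketAt 𝕜 D α v) :=
  AddSubgroup.closure
    {t | ∃ (x : D α v) (y : ∀ β : {β : A // β ≠ α}, MPacket1 D β.1),
      x ∈ I α v ∧ (∀ β, y β ∈ shellPacket1 D I β.1) ∧ t = x ⊗ₜ tprod 𝕜 y}

/-- `𝓘^ℚ((−))` := "the `ℚ`-span of `𝓘((−))`" ([IUTchIII] Proposition 3.2 (ii), p. 99), for any of
the ambient packets; typed as the `𝕜`-span (for a compact open `ℤ_p`-lattice in a `ℚ_p`-space, and
for the closed unit ball of a normed `ℝ`-space, the `ℚ`-span and the `𝕜`-span coincide).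
[claim: Mochizuki2012, status: disputed] -/
def shellQSpan {X : Type*} [AddCommGroup X] [Module 𝕜 X] (I : AddSubgroup X) : Submodule 𝕜 X :=
  Submodule.span 𝕜 (I : Set X)

/-- [IUTchIII] Proposition 3.2 (ii), p. 98: the submodules `𝓘(…)` "may be regarded as integral
structures on the `ℚ`-spans of these submodules" — typed as: `𝓘` spans `𝓘^ℚ` (tautological from
`shellQSpan`) and `𝓘 ⊆ 𝓘^ℚ`. [claim: Mochizuki2012, status: disputed] -/
theorem shell_le_shellQSpan {X : Type*} [AddCommGroup X] [Module 𝕜 X] (I : AddSubgroup X) :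
    (I : Set X) ⊆ shellQSpan 𝕜 I :=
  Submodule.subset_span

/-- [IUTchIII] Proposition 3.2 (ii), archimedean `v_ℚ`, pp. 98–99: "by regarding the mono-analytic
log-shell `𝓘_{†𝒟^⊢_v}` … as the closed unit ball of a Hermitian metric on `log(†𝒟^⊢_v)`, and
considering the induced direct sum Hermitian metric on `log(^α𝒟^⊢_{v_ℚ})`, together with the
induced tensor product Hermitian metric on `log(^A𝒟^⊢_{v_ℚ})`, one obtains Hermitian metrics …
whose associated closed unit balls `𝓘(^α𝒟^⊢_{v_ℚ})`, `𝓘(^A𝒟^⊢_{v_ℚ})`, `𝓘(^{A,α}𝒟^⊢_v)` may be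
regarded as integral structures". INTERFACE datum: the three families of unit balls, with the
printed compatibility that the 1-packet ball is the product of the component balls recorded as a
field (direct sum metric ⇒ sup-norm ball; TODO(general form): Hermitian tensor-product metrics on
`PiTensorProduct`s are not in Mathlib). [claim: Mochizuki2012, status: disputed] -/
structure ArchimedeanShellData (I : ∀ α v, Set (D α v)) where
  /-- `𝓘(^α𝒟^⊢_{v_ℚ})`, the closed unit ball of the direct sum Hermitian metric -/
  ball1 : ∀ α, Set (MPacket1 D α)
  /-- `𝓘(^A𝒟^⊢_{v_ℚ})`, the closed unit ball of the tensor product Hermitian metric -/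
  ballN : Set (MPacketN 𝕜 D)
  /-- `𝓘(^{A,α}𝒟^⊢_v)` -/
  ballAt : ∀ α v, Set (MPacketAt 𝕜 D α v)
  /-- the 1-packet ball is contained in the product of the component balls `𝓘_{^α𝒟^⊢_v}` -/
  ball1_subset_pi : ∀ α, ball1 α ⊆ Set.univ.pi fun v => I α v

/-- [IUTchIII] Proposition 3.2 (ii), last sentence, p. 99: the notation `𝓘((−))`, `𝓘^ℚ((−))` is
applied "with `𝒟^⊢` replaced by `𝓕` or `𝓕^{⊢×μ}` for the various objects obtained from the
`𝒟^⊢`-versions … by applying the natural poly-isomorphisms of (i)": the holomorphic log-shell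
`𝓘(^A𝓕_{v_ℚ}) ⊆ log(^A𝓕_{v_ℚ})` transported along a member of the compatibility isomorphism.
[claim: Mochizuki2012, status: disputed] -/
noncomputable def shellPacketN.transport (I : ∀ α v, AddSubgroup (D α v)) (e : ∀ α v, D α v ≃ₗ[𝕜] L α v) :
    AddSubgroup (PacketN 𝕜 L) :=
  (shellPacketN 𝕜 D I).map (MPacketN.compat e).toLinearMap.toAddMonoidHom

/-- [IUTchIII] Remark 3.2.1, p. 99: "The issue of estimating the discrepancy between the
holomorphic integral structures of Proposition 3.1, (ii), and the mono-analytic integral structures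
of Proposition 3.2, (ii), will form one of the main topics … in [IUTchIV]" — the discrepancy datum,
typed as the pair (transported mono-analytic shell, holomorphic integral structure) inside
`log(^A𝓕_{v_ℚ})` whose comparison [IUTchIV] §1 computes. [claim: Mochizuki2012, status: disputed] -/
noncomputable def integralStructureDiscrepancyDatum (I : ∀ α v, AddSubgroup (D α v))
    (e : ∀ α v, D α v ≃ₗ[𝕜] L α v) (OA : Subring (PacketN 𝕜 L)) :
    AddSubgroup (PacketN 𝕜 L) × Subring (PacketN 𝕜 L) :=
  (shellPacketN.transport 𝕜 D I e, OA)

/-- [IUTchIII] Remark 3.2.2, p. 99: "The constructions involving local mono-analytic tensor packets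
given in Proposition 3.2 may be applied to the capsules that appear in the various
`𝒟^⊢`-prime-strip processions — i.e., mono-analytic processions" ([IUTchI] Prop. 4.11 (ii), 6.9
(ii)): the mono-analytic `n`-tensor packet of the `(j+1)`-capsule, index set `S^±_{j+1} = Fin (j+1)`.
[claim: Mochizuki2012, status: disputed] -/
abbrev MProcessionPacket (j : ℕ) (Dj : Fin (j + 1) → Vfib → Type w)
    [∀ α v, AddCommGroup (Dj α v)] [∀ α v, Module 𝕜 (Dj α v)] : Type _ :=
  MPacketN 𝕜 Dj

end MonoAnalytic

/-! ### Proposition 3.1 (ii), direct-summand clause — corrected reading (appended) -/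

section DirectSummandCorrected

variable (𝕜 : Type u) [Field 𝕜]
variable {A : Type v} [Fintype A] [DecidableEq A]
variable {Vfib : Type v'} [Fintype Vfib] [DecidableEq Vfib]
variable (L : A → Vfib → Type w) [∀ α v, CommRing (L α v)] [∀ α v, Algebra 𝕜 (L α v)]

/-- [IUTchIII] Proposition 3.1 (ii), p. 93: "`log(^{A,α}𝓕_v)` forms a direct summand of the
ind-topological ring `log(^A𝓕_{v_ℚ})`" — CORRECTED typed reading (supersedes the reading recorded in
`Prop31ii_directSummand` above, which asks for a UNITAL algebra homomorphism with a linear retraction: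
the inclusion of a ring-theoretic direct summand is not unital, so that reading is stronger than, and
not implied by, the printed sentence): the `n`-tensor packet is isomorphic, as a `𝕜`-algebra, to the
product of `log(^{A,α}𝓕_v)` with a complementary `𝕜`-algebra — namely (via `packetDecomposition`) the
product of the summands `⊗_β log(^β𝓕_{v_β})` over the collections `{v_β}` with `v_α ≠ v`.
[claim: Mochizuki2012, status: disputed] -/
def Prop31ii_directSummand' (α : A) (v : Vfib) : Prop :=
  ∃ (C : Type (max u v v' w)) (_ : CommRing C) (_ : Algebra 𝕜 C),
    Nonempty (PacketN 𝕜 L ≃ₐ[𝕜] PacketAt 𝕜 L α v × C)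

end DirectSummandCorrected

/-! ### Proposition 3.1 (i) — finite-level statement WITH its hypotheses (appended; RQ7 finding L6-F1) -/

section RingStructuresCorrected

variable (𝕜 : Type u) [Field 𝕜]
variable {A : Type v} [Fintype A] [DecidableEq A]
variable {Vfib : Type v'} [Fintype Vfib] [DecidableEq Vfib]
variable (L : A → Vfib → Type w) [∀ α v, Field (L α v)] [∀ α v, Algebra 𝕜 (L α v)]
  [∀ α v, Module.Finite 𝕜 (L α v)] [∀ α v, Algebra.IsSeparable 𝕜 (L α v)]

/-- [IUTchIII] Proposition 3.1 (i) "(Ring Structures)", p. 93, FINITE-LEVEL statement with the binders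
its reading requires (RQ7 audit finding L6-F1, abc-iut-L6-t20, INBOX 2026-08-25T19:28:31Z): the
earlier `Prop31i_ringStructures` is a SCHEMA over arbitrary commutative algebras `L α v` and is FALSE at
junk parameters and even at the Remark 3.1.1 (i) model `L α v = k̄` (where the printed statement is an
inductive LIMIT of direct sums of fields, not one finite product) — it must not be used as a discharge
target. The dischargeable finite-level content is THIS statement: when each `log(^α𝓕_v)` is replaced by a
finite separable field extension of `𝕜 = ℚ_{v_ℚ}` (a cofinal finite stage of the ind-object), the tensor
packet `⊗_α ⊕_v L α v` is a finite product of fields (a finite étale `𝕜`-algebra: reduced and artinian,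
`IsArtinianRing.equivPi`). TODO(general form): the ind-level statement "inductive limit of direct sums
of ind-topological fields" with its `^αΠ_v`-compatibility. [claim: Mochizuki2012, status: disputed] -/
def Prop31i_ringStructures' : Prop :=
  ∃ (ι : Type (max u v v' w)) (_ : Fintype ι) (K : ι → Type (max u v v' w))
    (_ : ∀ i, Field (K i)), Nonempty (PacketN 𝕜 L ≃+* ∀ i, K i)

end RingStructuresCorrected


section RingStructuresModel
variable (𝕜 : Type u) [Field 𝕜] {A : Type v} {Vfib : Type v'} (L : A → Vfib → Type w)
  [∀ α v, CommRing (L α v)] [∀ α v, Algebra 𝕜 (L α v)]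

/-- [IUTchIII] Prop. 3.1 (i), p. 93 l.3–6, at the MODEL level of Rmk. 3.1.1 (i) (`log(^α𝓕_v) ≅ k̄`; "an
inductive LIMIT of direct sums of ind-topological fields"): every finite subset of the packet lies in
a `𝕜`-subalgebra that is a finite product of fields. THIS is the predicate to instantiate at the model —
the finite-level schema `Prop31i_ringStructures` is FALSE at `L α v = k̄` (RQ7 L6-F1) and must never be
assumed there (abc-iut-L6-lead ruling D10 (a), INBOX 19:29:34Z). [claim: Mochizuki2012, status: disputed] -/
def Prop31i_locallyProductOfFields : Prop :=
  ∀ s : Finset (PacketN 𝕜 L), ∃ B : Subalgebra 𝕜 (PacketN 𝕜 L), (↑s : Set (PacketN 𝕜 L)) ⊆ B ∧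
    ∃ (ι : Type (max u v v' w)) (_ : Fintype ι) (K : ι → Type (max u v v' w)) (_ : ∀ i, Field (K i)),
      Nonempty (B ≃+* ∀ i, K i)

/-- Finite level ⇒ model level (`B = ⊤`) — PROVED. [claim: Mochizuki2012, status: disputed] -/
theorem Prop31i_locallyProductOfFields_of_ringStructures (h : Prop31i_ringStructures 𝕜 L) :
    Prop31i_locallyProductOfFields 𝕜 L := fun s => by
  obtain ⟨ι, hι, K, hK, ⟨e⟩⟩ := h
  exact ⟨⊤, fun x _ => Algebra.mem_top, ι, hι, K, hK, ⟨(Subalgebra.topEquiv).toRingEquiv.trans e⟩⟩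

end RingStructuresModel

end Literature.IUT.LogThetaLattice
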